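import Literature.MathematicalPhysics.QuantumFieldTheory.Balaban1983to89.B3Op116SourceForm
import Literature.MathematicalPhysics.QuantumFieldTheory.Balaban1983to89.B3Ineq210RegularBox
import Literature.MathematicalPhysics.QuantumFieldTheory.Balaban1983to89.B2Eq273NeumannLocality

/-!
# `Balaban1983to89.B2Eq268HiggsRegion` — [Balaban1982Higgs2] Lemma 2.4, proof step **(2.68)** p. 572 («Using the expansion formula
# (I.3.44) and Proposition I.2.2 we have (a_kG_k(□, A^{(k)})Q_k^*(A^{(k)})□₁φ)(x) = (a_kG_k(□, A₀)Q_k^*(A₀)□₁φ)(x) + (a_kG_k(□, A₀)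
# F_{2,k}(A^{(k)} − A₀, A₀)□₁φ)(x) + (a_kG_k(□, A₀)V_k(A^{(k)} − A₀, A₀)G_k(□, A^{(k)})Q_k^*(A^{(k)})□₁φ)(x) = (a_kG_k(□, A₀)Q_k^*(A₀)□₁φ)(x)
# + O((Lᵏε)^{κ₀})») ON THE (Higgs)₂,₃ CARRIER OF RECORD: the three-term identity EXACTLY for the typer's (2.56) `bgScalar256`, and the
# two remainder terms BOUNDED on a cell-product box `□` at a (I.2.23)-regular background by the row sums of the kernels (2.10)

statement-level skeleton of published theorems with citation tags; proofs where landed; nothing here is a claim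
about the Yang–Mills mass gap

PDF held: `paper:balaban1982-cmp86-higgs23-ii` (journal page = PDF page + 554), p. 572 [PDF 18] (text layer p0018 L17–25, re-read
this session); [Balaban1982Higgs1] p. 619 (3.44), p. 615 (3.16); [Balaban1983Higgs3] p. 426 (2.10).

CITATION HEADER (lean-in-tree rule).  T. Bałaban, *(Higgs)₂,₃ quantum fields in a finite volume. II. An upper bound*,
Commun. Math. Phys. **86** (1982) 555–594, doi:10.1007/bf01214890 [Balaban1982Higgs2]; inputs of part I, Commun. Math. Phys. **85**
(1982) 603–626 [Balaban1982Higgs1] and part III, Commun. Math. Phys. **88** (1983) 411–445 [Balaban1983Higgs3] AS LANDED in the tree.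
Cell `lit-balaban` (HOME `run/shared/lean/pub/lit-balaban/`), Phase-2 proof seat **p23** gen 21 (unit `lit-balaban-p23-g21`; free-target
protocol G.5-34(d), TAKING #4 line HOME/STATUS.md 2026-08-23T03:22:40Z); SKELETON row **B2.Lem2.4** (Lemma 2.4 (2.65)–(2.66) p. 572; fold
owner r02, second reader r14; decl of record `B2.Lemma24Printed`, head `proved p250408 · …` UNCHANGED — cells-only member; brick F4′ of
the seat's programme «(2.68)/(2.65) on the (Higgs)₂,₃ carrier of record», after F1 `B2Eq273GaugeCovariance` ✓ 77f594e2c6c4, F2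
`B2Eq273NeumannLocality` ✓ 01aafa818c0b, F3′ `B2Eq276HiggsRegion` p350431).  Cross-references: rows **B1.Eq3.44** ((I.3.44): p40's
`B3Eq116TwoSidedExpansion.eq344_model`), **B1.Eq3.16** / **B3.Eq1.16** (r14's THEOREM A `B3Op116SourceForm.opV_apply_eq_srcV` and row
toolkit `norm_propagatorK_srcV_apply_le`, p40's `B3Op116Pieces.fTwoAdj`), **B3.Eq2.10** (p35's `B3Ineq210RegularBox.ineq210_regularBox_explicit_small`
— (2.10) on cell-product boxes at every pair of points — with r14's pieces `B3Ineq210RegularRegion.pieceR`/`sum_pieceR`), **B2.Eq2.55**.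
USED BY NAME, never restated: the above, the typer's `B2Eq255Concrete.{bgScalar256_eq, cutTo, underRegion}`, p35's
`B1Ineq225RegularBox.{cellBox, isBigBlockUnion_cellBox}` and `B1Cor23RegularRegion.propagatorK_supported`, r14's `B1Eq230FluctCov.{Ix, cb}`,
`B3Ineq210RegularTorus.{mesh_eq_pow_mul, norm_avgQkAdj_apply'}`, `B1Eq353SupNorm.{norm_avgQkLin_apply_le, card_blockK}`,
`B2Eq230CondShiftBound.sum_exp_neg_tdist_le` with `B4Sect5Proof.latticeConst`, own F2 `B2Eq273NeumannLocality.{avgQk_blockIter_eq_zero,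
avgQkAdj_supported}`.

WHAT IS PRINTED (p. 572 [PDF 18]).  *«Let us denote by A₀ a constant configuration equal to A^{(k)}(y) at each point, thus A^{(k)} − A₀ =
O(p(Lᵏε)r(Lᵏε)). Using the expansion formula (I.3.44) and Proposition I.2.2 we have (a_kG_k(□, A^{(k)})Q_k^*(A^{(k)})□₁φ)(x) =
(a_kG_k(□, A₀)Q_k^*(A₀)□₁φ)(x) + (a_kG_k(□, A₀)F_{2,k}(A^{(k)} − A₀, A₀)□₁φ)(x) + (a_kG_k(□, A₀)V_k(A^{(k)} − A₀, A₀)G_k(□, A^{(k)})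
Q_k^*(A^{(k)})□₁φ)(x) = (a_kG_k(□, A₀)Q_k^*(A₀)□₁φ)(x) + O((Lᵏε)^{κ₀}), κ₀ > 0, (2.68) and similarly for the derivative.»*; [B1] p. 619:
*«G_k(Ω, A + B) = G_k(Ω, B) + G_k(Ω, B)V_k(A, B)G_k(Ω, A + B) (3.44)»*; [B3] p. 426: *«|G^η_{(j)}(Ω, B̃; x, x′)| ≤ O(1)(Lʲη)^{−d+2}
e^{−δ₁(Lʲη)^{−1}|x−x′|}, (2.10) and if the propagator is differentiated, then for each differentiation, there is an additional factor (Lʲη)^{−1}»*.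

THE ARGUMENT (print's two sentences, on the carrier; ε-lattice currency `ℓ = Lᵏε`, `κ = a_kℓ⁻²`).  (i) IDENTITY: with `A = A′ + B`,
(I.3.44) `G(A) = G(B) + G(B)V G(A)` (`V = V_k(A′,B) = H_k(Ω,B) − H_k(Ω,A)`) and `Q_k^*(A) = Q_k^*(B) + F₂^*` give
`κG(A)Q^*(A)ψ = κG(B)Q^*(B)ψ + κG(B)F₂^*ψ + G(B)V[κG(A)Q^*(A)ψ]`, `ψ = □₁φ` — print's three terms, the last one being `G(B)V` applied to
the small-field background `w = φ^{(k)}_□` itself.  (ii) BOUNDS: through r14's source form of `V` every term is a charge times a ROW of the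
kernel of `G_k(Ω,B)` or of its covariant derivative in the row variable (the `D^*M` term in the symmetric form, no `ε⁻¹`): with
`R₀(x) = Σ_{y∈Ω}Σ_i|G_k(Ω,B; x, y)e_i|`, `R₁(x) = Σ_{b⊂Ω}Σ_i|(D_BG_k(Ω,B)e_{(x,i)})(b)|`, `m = |e|sεd(Lᵏ−1)` (`sup|A′| ≤ s`),
`|κ(G(B)F₂^*ψ)(x)| ≤ κmt·R₀(x)` and `|(G(B)Vw)(x)| ≤ |e|s(W₁ + |e|sW₀)d·R₀(x) + |e|sW₀·R₁(x) + κ(2m + m²)W₀·R₀(x)` (`|w| ≤ W₀`, `|D_Bw| ≤ W₁`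
on the bonds of `Ω`).  (iii) ROWS: on a cell-product box `Ω` at a (I.2.23)-regular `B`, (2.10) for the pieces `G^η_{(j)}` (p35, every pair of
points of the box, derivative clause on the bonds inside) summed over the lattice (`Σ_ye^{−δ₁|x−y|/Lʲ} ≤ K_d(δ₁/Lʲ) ≤ Lʲᵈ(2(1+d/δ₁))ᵈ`) and over
the scales (`Σ_{j<k}(Lʲε)² ≤ ℓ²`, `Σ_{j<k}Lʲε ≤ ℓ`) give `R₀ ≤ C₁ℓ²`, `R₁ ≤ C₂ℓ` — print's «Proposition I.2.2».  Hence the remainder of (2.68) is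
`≤ C₁ℓ²[κmt + |e|sd(W₁ + |e|sW₀) + κ(2m + m²)W₀] + C₂ℓ|e|sW₀`, every factor carrying `|e|s` — print's `O((Lᵏε)^{κ₀})` once `s`, `W₀`, `W₁`, `t`
are read from (2.55)/(2.60) (the assembly's business).

WHAT THIS FILE PROVES (kernel-checked, zero `sorry`; theorems only — NO definition, NO `Prop`-valued fact; axioms standard).
 §1 **`eq268_identity`** (the three-term identity, every region/fields/`m² > 0`/`a_k ≥ 0`), `bgScalar256_eq_zero_of_not_mem` (`φ^{(k)}_□`
    vanishes off `□`).
 §2 lattice and scale sums (private `latticeConst_div_le`, `sum_pow_lt_le`), and **`row_sums_box`** (`R₀ ≤ C₁ℓ²`, `R₁ ≤ C₂ℓ` on a cell-product box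
    at a regular background, and the derivative COLUMN sum `Σ_{y∈□}Σ_i‖(D_BG_k(□,B)e_{(y,i)})(b)‖ ≤ C₂ℓ` at every bond `b ⊂ □`;
    p35-format quantifiers).
 §3 **`norm_T1_le`** (the `F₂` term by `R₀`), **`norm_T2_le`** (the `V` term by `R₀`, `R₁`).
 §4 **`eq268_box`**: ‖bgScalar256 □₂ □₁ (A′ + B) φ x − bgScalar256 □₂ □₁ B φ x‖ ≤ C₁ℓ²(κmt + |e|sd(W₁ + |e|sW₀) + κ(2m + m²)W₀) + C₂ℓ|e|sW₀
    for `Bᵏ(□₂)` a cell-product box, `□₁ ⊆ □₂`, `x ∈ Bᵏ(□₂)` (no depth needed: the box bounds are `R₀`-free).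

HONEST SCOPE / DIFFERENCES FROM PRINT (recorded, not hidden).  (a) `Ω = Bᵏ(□₂)` must be a cell-product box of big blocks (`cellBox`,
p35) — print's □ («sums of large blocks … distant from y less than 4r(Lᵏε)», a sup-distance ball of big blocks inside `Λ₂′`) is one;
hypotheses `K₀ ∣ M`, `3LᵏK₀ ≤ |T_ε|_μ`, `Lᵏε ≤ 1`, `1 ≤ k ≤ K`, `K₀ ≥ K₀min` are p35's.  (b) `B` any (I.2.23)-regular field with
`Lᵏδ_B|e| ≤ t` (print: the constant `A₀`, `δ_B = 0`); `A′` with `|A′_b| ≤ s` on ALL bonds (print: on `□`; the reduction to `□` is F2's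
locality `bgScalar256_congr`, used by the assembly).  (c) The value clause only — «and similarly for the derivative» is NOT done (it needs
the twice-differentiated kernels).  (d) The sizes `s = O(p·r·ℓ…)`, `W₀`, `W₁`, `t` from (2.55)/(2.60)/(2.66) and the conclusion `O((Lᵏε)^{κ₀})`
are the assembly's (brick F5); the constants `C₁, C₂` are explicit in p35's `Cst, δ₁` but not numerical.  Value = print's (2.68) now holds,
with explicit remainder, for the carrier of record's own `G^ε_k(□,·)` and `φ^{(k)}`; NOT summit progress.
-/

open scoped BigOperators

noncomputable section

namespace Literature.MathematicalPhysics.QuantumFieldTheory.Balaban1983to89.B2Eq268HiggsRegion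

open HiggsLattice (ChargeData covDeriv)
open HiggsAveraging (blockIter blockK mem_blockK)
open HiggsCovariance (propagatorK avgQkLin avgQkAdj E)
open HiggsCovariancePos (Inside shiftEquiv sum_site_dir)
open B2Eq255Concrete (bgScalar256 bgScalar256_eq cutTo cutTo_of_mem cutTo_of_not_mem underRegion mem_underRegion)
open B3Eq116TwoSidedExpansion (opV eq344_model)
open B3Op116Pieces (fTwo fTwoAdj avgQkAdj_add norm_fTwoAdj_apply_le norm_fTwo_apply_le)
open B3Op116SourceForm (srcV avgSrc opV_apply_eq_srcV norm_propagatorK_srcV_apply_le norm_mapE_le_sum_norm_mul_col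
  norm_mapE_avgSrc_le)
open B3Ineq210RegularRegion (pieceR sum_pieceR)
open B3Ineq210RegularBox (ineq210_regularBox_explicit_small)
open B3Ineq210RegularTorus (mesh_eq_pow_mul norm_avgQkAdj_apply')
open B1Ineq225RegularBox (cellBox mem_cellBox isBigBlockUnion_cellBox)
open B1Eq230FluctCov (Ix cb)
open B1Eq353SupNorm (norm_avgQkLin_apply_le card_blockK)
open B1Cor23RegularRegion (propagatorK_supported)
open B2Eq230CondShiftBound (sum_exp_neg_tdist_le)
open B4Sect5Proof (latticeConst latticeConst_nonneg)
open B1Ineq234LevelZero (tdist_comm)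
open B1TorusCubeCover (half)
open B3Ineq210RegularRegion (blockUnion_of_isBigBlockUnion)
open B2Eq273NeumannLocality (avgQk_blockIter_eq_zero avgQkAdj_supported)

variable {P : HiggsLattice.Params} {N : ℕ}

/-! ## §1 (2.68) as an identity: `κG(A)Q^*(A)ψ = κG(B)Q^*(B)ψ + κG(B)F₂^*ψ + G(B)V_k(A′,B)[κG(A)Q^*(A)ψ]`, `A = A′ + B` -/

section Identity

variable (C : ChargeData N) {k : ℕ}

/-- **(2.68), THE IDENTITY** on the carrier: for all regions `□₁, □₂ ⊂ T^{(k)}`, fields `A′, B`, `m² > 0`, `a_k ≥ 0`,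
`a_kG_k(□, A′+B)Q_k^*(A′+B)□₁φ = a_kG_k(□, B)Q_k^*(B)□₁φ + a_kG_k(□, B)F_{2,k}(A′, B)^*□₁φ + G_k(□, B)V_k(A′, B)[a_kG_k(□, A′+B)Q_k^*(A′+B)□₁φ]`
(`□ = Bᵏ(□₂)`; (I.3.44) from the left and `Q_k^*(A′+B) = Q_k^*(B) + F₂^*`). [cite: Balaban1982Higgs2, Lemma 2.4 proof (2.68) p.572]
[cite: Balaban1982Higgs1, (3.44) p.619] [cite: Balaban1982Higgs1, (3.16) p.615] -/
theorem eq268_identity (sq₂ sq₁ : Finset (HiggsLattice.Site P k)) (A' B : HiggsLattice.VecField P 0) {msq : ℝ} (hmsq : 0 < msq) (a : ℝ)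
    (hak : 0 ≤ B1.aSeq a P.L k) (φ : HiggsLattice.ScalarField P k N) :
    bgScalar256 C msq a k sq₂ sq₁ (A' + B) φ
      = bgScalar256 C msq a k sq₂ sq₁ B φ
        + (B1.aSeq a P.L k * (P.mesh k ^ 2)⁻¹) •
            propagatorK C (underRegion k sq₂) B msq a k (fTwoAdj C A' B k (cutTo sq₁ φ))
        + propagatorK C (underRegion k sq₂) B msq a k
            (opV C (underRegion k sq₂) A' B msq a k (bgScalar256 C msq a k sq₂ sq₁ (A' + B) φ)) := by
  set Ω := underRegion k sq₂ with hΩ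
  have h344 := eq344_model C Ω A' B a k hmsq hak
  have hG : ∀ v : HiggsLattice.ScalarField P 0 N, propagatorK C Ω (A' + B) msq a k v
      = propagatorK C Ω B msq a k v
        + propagatorK C Ω B msq a k (opV C Ω A' B msq a k (propagatorK C Ω (A' + B) msq a k v)) := by
    intro v
    have h := LinearMap.congr_fun h344 v
    rw [LinearMap.add_apply, Module.End.mul_apply, Module.End.mul_apply] at h
    exact h
  rw [bgScalar256_eq, bgScalar256_eq]
  set ψ := cutTo sq₁ φ with hψ
  set κ : ℝ := B1.aSeq a P.L k * (P.mesh k ^ 2)⁻¹ with hκ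
  have h1 : propagatorK C Ω B msq a k (avgQkAdj C (A' + B) k ψ)
      = propagatorK C Ω B msq a k (avgQkAdj C B k ψ) + propagatorK C Ω B msq a k (fTwoAdj C A' B k ψ) := by
    rw [avgQkAdj_add C A' B k, LinearMap.add_apply, map_add]
  have h2 : κ • propagatorK C Ω B msq a k (opV C Ω A' B msq a k
        (propagatorK C Ω (A' + B) msq a k (avgQkAdj C (A' + B) k ψ)))
      = propagatorK C Ω B msq a k (opV C Ω A' B msq a k
        (κ • propagatorK C Ω (A' + B) msq a k (avgQkAdj C (A' + B) k ψ))) := by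
    simp only [map_smul]
  conv_lhs => rw [hG]
  rw [smul_add, h1, smul_add, h2]

variable {C}

/-- the small-field background `φ^{(k)}_□ = a_kG_k(□, A)Q_k^*(A)□₁φ` vanishes off `□ = Bᵏ(□₂)` when `□₁ ⊆ □₂` (`m² > 0`, `a_k ≥ 0`; p35's
`propagatorK_supported`). [cite: Balaban1982Higgs2, (2.56) p.570] [cite: Balaban1982Higgs1, (2.20) p.610] -/
theorem bgScalar256_eq_zero_of_not_mem {msq : ℝ} (hmsq : 0 < msq) {a : ℝ} (hak : 0 ≤ B1.aSeq a P.L k)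
    {sq₂ sq₁ : Finset (HiggsLattice.Site P k)} (h12 : sq₁ ⊆ sq₂) (A : HiggsLattice.VecField P 0) (φ : HiggsLattice.ScalarField P k N)
    {y : HiggsLattice.Site P 0} (hy : y ∉ underRegion k sq₂) :
    bgScalar256 C msq a k sq₂ sq₁ A φ y = 0 := by
  have hΩ : ∀ x x' : HiggsLattice.Site P 0, blockIter k x = blockIter k x' →
      (x ∈ underRegion k sq₂ ↔ x' ∈ underRegion k sq₂) := by
    intro x x' h
    rw [mem_underRegion, mem_underRegion, h]
  have hψ : ∀ x : HiggsLattice.Site P 0, x ∉ underRegion k sq₂ → cutTo sq₁ φ (blockIter k x) = 0 := by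
    intro x hx
    rw [mem_underRegion] at hx
    exact cutTo_of_not_mem sq₁ φ fun h => hx (h12 h)
  rw [bgScalar256_eq, Pi.smul_apply,
    propagatorK_supported C (underRegion k sq₂) A hmsq hak hΩ _ (avgQkAdj_supported C A (cutTo sq₁ φ) hψ) y hy, smul_zero]

end Identity

/-! ## §2 The row sums of the kernels (2.10) on a cell-product box: `R₀ ≤ C₁ℓ²`, `R₁ ≤ C₂ℓ` -/

section Rows

/-- `K_d(δ/r) ≤ rᵈ·(2(1 + d/δ))ᵈ` for `r ≥ 1`, `δ > 0`, `d ≥ 1` (`(1 − e^{−u})⁻¹ ≤ 1 + u⁻¹`). [folklore] -/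
private theorem latticeConst_div_le {d : ℕ} (hd : 1 ≤ d) {δ : ℝ} (hδ : 0 < δ) {r : ℝ} (hr : 1 ≤ r) :
    latticeConst d (δ / r) ≤ (r * (2 * (1 + d / δ))) ^ d := by
  unfold latticeConst
  have hdpos : (0 : ℝ) < d := by exact_mod_cast hd
  have hrpos : 0 < r := by linarith
  set u : ℝ := δ / r / d with hu
  have hupos : 0 < u := by positivity
  have hexp : Real.exp (-u) ≤ 1 / (1 + u) := by
    rw [Real.exp_neg, one_div]
    exact inv_anti₀ (by positivity) (by linarith [Real.add_one_le_exp u])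
  have h1 : u / (1 + u) ≤ 1 - Real.exp (-u) := by
    have : u / (1 + u) = 1 - 1 / (1 + u) := by
      field_simp
      ring
    rw [this]
    linarith
  have hfrac : 0 < u / (1 + u) := by positivity
  have hbase : 2 * (1 - Real.exp (-u))⁻¹ ≤ r * (2 * (1 + d / δ)) := by
    have hinv : (1 - Real.exp (-u))⁻¹ ≤ (u / (1 + u))⁻¹ := inv_anti₀ hfrac h1
    have hinv' : (u / (1 + u))⁻¹ = 1 + r * d / δ := by
      rw [hu]
      field_simp
      ring
    have hle : 1 + r * d / δ ≤ r * (1 + d / δ) := by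
      have h' : r * (1 + d / δ) = r + r * d / δ := by ring
      rw [h']
      linarith
    calc 2 * (1 - Real.exp (-u))⁻¹ ≤ 2 * (1 + r * d / δ) := by
          refine mul_le_mul_of_nonneg_left (hinv.trans (le_of_eq hinv')) (by norm_num)
      _ ≤ 2 * (r * (1 + d / δ)) := by linarith
      _ = r * (2 * (1 + d / δ)) := by ring
  have hb0 : 0 ≤ 2 * (1 - Real.exp (-u))⁻¹ :=
    mul_nonneg (by norm_num) (inv_nonneg.2 (le_trans hfrac.le h1))
  have harg : -(δ / r / (d : ℝ)) = -u := by rw [hu]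
  rw [harg]
  exact pow_le_pow_left₀ hb0 hbase d

/-- `Σ_{j<k} rʲ ≤ rᵏ` for `r ≥ 2`. [folklore] -/
private theorem sum_pow_lt_le {r : ℝ} (hr : 2 ≤ r) (k : ℕ) : ∑ j ∈ Finset.range k, r ^ j ≤ r ^ k := by
  induction k with
  | zero => simp
  | succ n ih =>
      rw [Finset.sum_range_succ, pow_succ]
      have hrn : 0 ≤ r ^ n := pow_nonneg (by linarith) n
      nlinarith

/-- `(Lʲε)^{2−d} = (Lʲε)²·((Lʲε)ᵈ)⁻¹`. [folklore] -/
private theorem rpow_two_sub (j : ℕ) : P.mesh j ^ ((2 : ℝ) - (P.d : ℝ)) = P.mesh j ^ 2 * (P.mesh j ^ P.d)⁻¹ := by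
  rw [Real.rpow_sub (P.mesh_pos j), div_eq_mul_inv, Real.rpow_natCast _ P.d, Real.rpow_two]

/-- `(Lʲε)^{1−d} = (Lʲε)·((Lʲε)ᵈ)⁻¹`. [folklore] -/
private theorem rpow_one_sub (j : ℕ) : P.mesh j ^ ((1 : ℝ) - (P.d : ℝ)) = P.mesh j * (P.mesh j ^ P.d)⁻¹ := by
  rw [Real.rpow_sub (P.mesh_pos j), div_eq_mul_inv, Real.rpow_natCast _ P.d, Real.rpow_one]

/-- `εᵈ·((Lʲε)ᵈ)⁻¹ = (Lʲ)^{−d}`. [cite: Balaban1982Higgs1, (1.19) p.607] -/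
private theorem eps_pow_mul_inv (j : ℕ) :
    P.mesh 0 ^ P.d * (P.mesh j ^ P.d)⁻¹ = (((P.L : ℝ) ^ j) ^ P.d)⁻¹ := by
  have hε : P.mesh 0 ≠ 0 := (P.mesh_pos 0).ne'
  have hL : ((P.L : ℝ) ^ j) ≠ 0 := pow_ne_zero _ (Nat.cast_pos.mpr P.hL).ne'
  rw [mesh_eq_pow_mul P j, mul_pow]
  field_simp

/-- the rate: `δ₁(Lʲε)⁻¹·(ε|x−y|) = (δ₁/Lʲ)·|x−y|`. [cite: Balaban1983Higgs3, (2.10) p.426] -/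
private theorem rate_eq (j : ℕ) (δ₁ τ : ℝ) :
    δ₁ * (P.mesh j)⁻¹ * (P.mesh 0 * τ) = δ₁ / (P.L : ℝ) ^ j * τ := by
  have hε : P.mesh 0 ≠ 0 := (P.mesh_pos 0).ne'
  have hL : ((P.L : ℝ) ^ j) ≠ 0 := pow_ne_zero _ (Nat.cast_pos.mpr P.hL).ne'
  rw [mesh_eq_pow_mul P j]
  field_simp

/-- the lattice sum at rate `δ₁/Lʲ`: `Σ_{y}e^{−(δ₁/Lʲ)|x−y|} ≤ Lʲᵈ(2(1+d/δ₁))ᵈ`. [folklore] -/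
private theorem sum_exp_rate_le (hd : 1 ≤ P.d) {δ₁ : ℝ} (hδ₁ : 0 < δ₁) (j : ℕ) (x : HiggsLattice.Site P 0)
    (S : Finset (HiggsLattice.Site P 0)) :
    ∑ y ∈ S, Real.exp (-(δ₁ / (P.L : ℝ) ^ j * (HiggsLattice.Site.tdist x y : ℝ)))
      ≤ ((P.L : ℝ) ^ j) ^ P.d * (2 * (1 + P.d / δ₁)) ^ P.d := by
  have hL1 : (1 : ℝ) ≤ (P.L : ℝ) := by exact_mod_cast (P.hL : 1 ≤ P.L)
  have hLj : (1 : ℝ) ≤ (P.L : ℝ) ^ j := one_le_pow₀ hL1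
  have hrate : 0 < δ₁ / (P.L : ℝ) ^ j := div_pos hδ₁ (by positivity)
  calc ∑ y ∈ S, Real.exp (-(δ₁ / (P.L : ℝ) ^ j * (HiggsLattice.Site.tdist x y : ℝ)))
      ≤ ∑ y : HiggsLattice.Site P 0, Real.exp (-(δ₁ / (P.L : ℝ) ^ j * (HiggsLattice.Site.tdist x y : ℝ))) :=
        Finset.sum_le_sum_of_subset_of_nonneg (Finset.subset_univ S) fun y _ _ => Real.exp_nonneg _
    _ ≤ latticeConst P.d (δ₁ / (P.L : ℝ) ^ j) := sum_exp_neg_tdist_le hrate x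
    _ ≤ ((P.L : ℝ) ^ j * (2 * (1 + P.d / δ₁))) ^ P.d := latticeConst_div_le hd hδ₁ hLj
    _ = ((P.L : ℝ) ^ j) ^ P.d * (2 * (1 + P.d / δ₁)) ^ P.d := mul_pow _ _ _

/-- **THE ROW SUMS OF `G_k(Ω, B)` AND OF `D_BG_k(Ω, B)` ON A CELL-PRODUCT BOX** (ε-lattice currency).  For `d ≥ 1`, `L ≥ 2`, `a, m² > 0`,
`N`, charge data: there are `K₀min` and, per `K₀ ≥ K₀min`, a smallness threshold `t > 0` and constants `C₁, C₂ ≥ 0` such that on every torus of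
the carrier with `K₀ ∣ M`, at every level `1 ≤ k ≤ K_P` with `3LᵏK₀ ≤ |T_ε|_μ`, `Lᵏε ≤ 1`, for every cell-product box `Ω` and every field `B`
with `|B(z+e_ν, μ) − B(z, μ)| ≤ δ_B` on `Ω`, `Lᵏδ_B|e| ≤ t`, at every `x ∈ Ω`:
`Σ_{y∈Ω}Σ_i‖(G_k(Ω,B)e_{(y,i)})(x)‖ ≤ C₁(Lᵏε)²` and `Σ_{b⊂Ω}Σ_i‖(D_BG_k(Ω,B)e_{(x,i)})(b)‖ ≤ C₂(Lᵏε)` — (2.10) for the pieces summed over the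
lattice and the scales. [cite: Balaban1983Higgs3, (2.10) p.426] [cite: Balaban1982Higgs1, Prop. 2.1 p.611 «for rectangular parallelepipeds, the inequalities hold without any restrictions on the points x, x′»]
[cite: Balaban1982Higgs2, Lemma 2.4 proof (2.68) p.572 «and Proposition I.2.2»] -/
theorem row_sums_box (d L : ℕ) (hd : 1 ≤ d) (hL : 2 ≤ L) {a : ℝ} (ha : 0 < a) {msq : ℝ} (hmsq : 0 < msq)
    (N : ℕ) (C : ChargeData N) :
    ∃ K₀min : ℕ, ∀ K₀ : ℕ, K₀min ≤ K₀ → ∃ t C₁ C₂ : ℝ, 0 < t ∧ 0 ≤ C₁ ∧ 0 ≤ C₂ ∧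
      ∀ (P : HiggsLattice.Params), P.d = d → P.L = L → K₀ ∣ P.M →
      ∀ {k : ℕ}, 1 ≤ k → k ≤ P.K → (∀ μ, 3 * half P k K₀ ≤ P.sitesPerDir 0 μ) → P.mesh k ≤ 1 →
      ∀ (S : Fin P.d → Finset ℕ) (B : HiggsLattice.VecField P 0) {δB : ℝ}, 0 ≤ δB →
        (∀ z ∈ cellBox k K₀ S, ∀ μ ν : Fin P.d, |B ⟨z.shift ν, μ⟩ - B ⟨z, μ⟩| ≤ δB) →
        (P.L : ℝ) ^ k * δB * |C.e| ≤ t →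
        (∀ x ∈ cellBox k K₀ S,
          (∑ y ∈ cellBox k K₀ S, ∑ i : Ix N,
              ‖propagatorK C (cellBox k K₀ S) B msq a k (cb P N 0 (y, i)) x‖ ≤ C₁ * P.mesh k ^ 2) ∧
          (∑ b : HiggsLattice.PBond P 0, (if Inside (cellBox k K₀ S) b then
              ∑ i : Ix N, ‖covDeriv C B (propagatorK C (cellBox k K₀ S) B msq a k (cb P N 0 (x, i))) b‖ else 0))
            ≤ C₂ * P.mesh k) ∧
        (∀ b : HiggsLattice.PBond P 0, Inside (cellBox k K₀ S) b →
          ∑ y ∈ cellBox k K₀ S, ∑ i : Ix N,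
              ‖covDeriv C B (propagatorK C (cellBox k K₀ S) B msq a k (cb P N 0 (y, i))) b‖ ≤ C₂ * P.mesh k) := by
  obtain ⟨K₀min, h⟩ := ineq210_regularBox_explicit_small d L hd hL ha hmsq N C
  refine ⟨K₀min, fun K₀ hK₀ => ?_⟩
  obtain ⟨t, δ₁, Cst, ht, hδ₁, hCst, h⟩ := h K₀ hK₀
  set Kδ : ℝ := (2 * (1 + d / δ₁)) ^ d with hKδ
  have hKδ0 : 0 ≤ Kδ := by positivity
  refine ⟨t, Cst * Kδ, Cst * Kδ * d, ht, by positivity, by positivity, ?_⟩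
  intro P hPd hPL hK₀M k hk1 hkK h3 hmesh S B δB hδB hreg ht'
  have hP1 : 1 < P.L := by rw [hPL]; omega
  have hLr : (1 : ℝ) < P.L := by exact_mod_cast hP1
  have hL2 : (2 : ℝ) ≤ P.L := by rw [hPL]; exact_mod_cast hL
  have hdP : 1 ≤ P.d := by rw [hPd]; exact hd
  have hpiece := h P hP1 hPd hPL hK₀M hk1 hkK h3 hmesh S B hδB hreg ht'
  set Ω := cellBox k K₀ S with hΩdef
  have hεpos : 0 < P.mesh 0 := P.mesh_pos 0
  have hεd : 0 < P.mesh 0 ^ P.d := pow_pos hεpos _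
  have hKδP : (2 * (1 + (P.d : ℝ) / δ₁)) ^ P.d = Kδ := by rw [hKδ, hPd]
  -- the decomposition `G_k = Σ_{j<k} G^η_{(j)}`
  have hsum := sum_pieceR (C := C) (Ω := Ω) (A := B) (msq := msq) (a := a) hmsq ha hP1 hk1 hkK
  -- per piece, the value row
  have hV : ∀ x ∈ Ω, ∀ j, ∑ y ∈ Ω, ∑ i : Ix N, ‖pieceR C Ω B msq a k j (cb P N 0 (y, i)) x‖
      ≤ Cst * Kδ * P.mesh j ^ 2 := by
    intro x hx j
    have hmj : 0 < P.mesh j := P.mesh_pos j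
    have hLjd : 0 < ((P.L : ℝ) ^ j) ^ P.d := by positivity
    have hy : ∀ y ∈ Ω, ∑ i : Ix N, ‖pieceR C Ω B msq a k j (cb P N 0 (y, i)) x‖
        ≤ Cst * P.mesh j ^ 2 * (((P.L : ℝ) ^ j) ^ P.d)⁻¹ *
            Real.exp (-(δ₁ / (P.L : ℝ) ^ j * (HiggsLattice.Site.tdist x y : ℝ))) := by
      intro y hy
      have hb := (hpiece j x y hx hy).1
      rw [inv_mul_le_iff₀ hεd, rpow_two_sub, rate_eq] at hb
      refine hb.trans (le_of_eq ?_)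
      rw [← eps_pow_mul_inv j]
      ring
    calc ∑ y ∈ Ω, ∑ i : Ix N, ‖pieceR C Ω B msq a k j (cb P N 0 (y, i)) x‖
        ≤ ∑ y ∈ Ω, Cst * P.mesh j ^ 2 * (((P.L : ℝ) ^ j) ^ P.d)⁻¹ *
            Real.exp (-(δ₁ / (P.L : ℝ) ^ j * (HiggsLattice.Site.tdist x y : ℝ))) := Finset.sum_le_sum hy
      _ = Cst * P.mesh j ^ 2 * (((P.L : ℝ) ^ j) ^ P.d)⁻¹ *
            ∑ y ∈ Ω, Real.exp (-(δ₁ / (P.L : ℝ) ^ j * (HiggsLattice.Site.tdist x y : ℝ))) := by rw [Finset.mul_sum]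
      _ ≤ Cst * P.mesh j ^ 2 * (((P.L : ℝ) ^ j) ^ P.d)⁻¹ * (((P.L : ℝ) ^ j) ^ P.d * (2 * (1 + P.d / δ₁)) ^ P.d) :=
          mul_le_mul_of_nonneg_left (sum_exp_rate_le hdP hδ₁ j x Ω)
            (mul_nonneg (mul_nonneg hCst.le (sq_nonneg _)) (inv_nonneg.2 hLjd.le))
      _ = Cst * Kδ * P.mesh j ^ 2 := by
          rw [← hKδP]
          have hL0 : (((P.L : ℝ) ^ j) ^ P.d) ≠ 0 := by positivity
          field_simp
  -- per piece, the derivative row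
  have hD : ∀ x ∈ Ω, ∀ j, ∑ b : HiggsLattice.PBond P 0, (if Inside Ω b then
      ∑ i : Ix N, ‖covDeriv C B (pieceR C Ω B msq a k j (cb P N 0 (x, i))) b‖ else 0) ≤ Cst * Kδ * d * P.mesh j := by
    intro x hx j
    have hmj : 0 < P.mesh j := P.mesh_pos j
    have hLjd : 0 < ((P.L : ℝ) ^ j) ^ P.d := by positivity
    have hb : ∀ b : HiggsLattice.PBond P 0, (if Inside Ω b then
        ∑ i : Ix N, ‖covDeriv C B (pieceR C Ω B msq a k j (cb P N 0 (x, i))) b‖ else 0)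
          ≤ Cst * P.mesh j * (((P.L : ℝ) ^ j) ^ P.d)⁻¹ *
              Real.exp (-(δ₁ / (P.L : ℝ) ^ j * (HiggsLattice.Site.tdist x b.src : ℝ))) := by
      intro b
      split_ifs with hin
      · have hd' := (hpiece j b.src x hin.1 hx).2 b.dir hin.2
        rw [inv_mul_le_iff₀ hεd, rpow_one_sub, rate_eq, tdist_comm] at hd'
        refine hd'.trans (le_of_eq ?_)
        rw [← eps_pow_mul_inv j]
        ring
      · positivity
    calc ∑ b : HiggsLattice.PBond P 0, (if Inside Ω b then
            ∑ i : Ix N, ‖covDeriv C B (pieceR C Ω B msq a k j (cb P N 0 (x, i))) b‖ else 0)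
        ≤ ∑ b : HiggsLattice.PBond P 0, Cst * P.mesh j * (((P.L : ℝ) ^ j) ^ P.d)⁻¹ *
              Real.exp (-(δ₁ / (P.L : ℝ) ^ j * (HiggsLattice.Site.tdist x b.src : ℝ))) := Finset.sum_le_sum fun b _ => hb b
      _ = Cst * P.mesh j * (((P.L : ℝ) ^ j) ^ P.d)⁻¹ *
            ∑ z : HiggsLattice.Site P 0, ∑ _μ : Fin P.d, Real.exp (-(δ₁ / (P.L : ℝ) ^ j * (HiggsLattice.Site.tdist x z : ℝ))) := by
          rw [sum_site_dir, Finset.mul_sum]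
      _ = Cst * P.mesh j * (((P.L : ℝ) ^ j) ^ P.d)⁻¹ *
            (P.d * ∑ z : HiggsLattice.Site P 0, Real.exp (-(δ₁ / (P.L : ℝ) ^ j * (HiggsLattice.Site.tdist x z : ℝ)))) := by
          congr 1
          rw [Finset.mul_sum]
          refine Finset.sum_congr rfl fun z _ => ?_
          rw [Finset.sum_const, Finset.card_univ, Fintype.card_fin, nsmul_eq_mul]
      _ ≤ Cst * P.mesh j * (((P.L : ℝ) ^ j) ^ P.d)⁻¹ *
            (P.d * (((P.L : ℝ) ^ j) ^ P.d * (2 * (1 + P.d / δ₁)) ^ P.d)) := by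
          refine mul_le_mul_of_nonneg_left (mul_le_mul_of_nonneg_left ?_ (Nat.cast_nonneg _)) (by positivity)
          have h := sum_exp_rate_le hdP hδ₁ j x (Finset.univ : Finset (HiggsLattice.Site P 0))
          exact h
      _ = Cst * Kδ * d * P.mesh j := by
          rw [← hKδP, hPd]
          have hL0 : (((L : ℝ) ^ j) ^ d) ≠ 0 := by
            have : (0 : ℝ) < L := by exact_mod_cast (by omega : 0 < L)
            positivity
          rw [hPL]
          field_simp
  -- per piece, the derivative column sum at a fixed inside bond
  have hDT : ∀ b : HiggsLattice.PBond P 0, Inside Ω b → ∀ j,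
      ∑ y ∈ Ω, ∑ i : Ix N, ‖covDeriv C B (pieceR C Ω B msq a k j (cb P N 0 (y, i))) b‖ ≤ Cst * Kδ * P.mesh j := by
    intro b hin j
    have hmj : 0 < P.mesh j := P.mesh_pos j
    have hLjd : 0 < ((P.L : ℝ) ^ j) ^ P.d := by positivity
    have hy : ∀ y ∈ Ω, ∑ i : Ix N, ‖covDeriv C B (pieceR C Ω B msq a k j (cb P N 0 (y, i))) b‖
        ≤ Cst * P.mesh j * (((P.L : ℝ) ^ j) ^ P.d)⁻¹ *
            Real.exp (-(δ₁ / (P.L : ℝ) ^ j * (HiggsLattice.Site.tdist b.src y : ℝ))) := by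
      intro y hy
      have hd' := (hpiece j b.src y hin.1 hy).2 b.dir hin.2
      rw [inv_mul_le_iff₀ hεd, rpow_one_sub, rate_eq] at hd'
      refine hd'.trans (le_of_eq ?_)
      rw [← eps_pow_mul_inv j]
      ring
    calc ∑ y ∈ Ω, ∑ i : Ix N, ‖covDeriv C B (pieceR C Ω B msq a k j (cb P N 0 (y, i))) b‖
        ≤ ∑ y ∈ Ω, Cst * P.mesh j * (((P.L : ℝ) ^ j) ^ P.d)⁻¹ *
            Real.exp (-(δ₁ / (P.L : ℝ) ^ j * (HiggsLattice.Site.tdist b.src y : ℝ))) := Finset.sum_le_sum hy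
      _ = Cst * P.mesh j * (((P.L : ℝ) ^ j) ^ P.d)⁻¹ *
            ∑ y ∈ Ω, Real.exp (-(δ₁ / (P.L : ℝ) ^ j * (HiggsLattice.Site.tdist b.src y : ℝ))) := by rw [Finset.mul_sum]
      _ ≤ Cst * P.mesh j * (((P.L : ℝ) ^ j) ^ P.d)⁻¹ * (((P.L : ℝ) ^ j) ^ P.d * (2 * (1 + P.d / δ₁)) ^ P.d) :=
          mul_le_mul_of_nonneg_left (sum_exp_rate_le hdP hδ₁ j b.src Ω)
            (mul_nonneg (mul_nonneg hCst.le hmj.le) (inv_nonneg.2 hLjd.le))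
      _ = Cst * Kδ * P.mesh j := by
          rw [← hKδP]
          have hL0 : (((P.L : ℝ) ^ j) ^ P.d) ≠ 0 := by positivity
          field_simp
  -- the scale sums
  have hmesh2 : ∑ j ∈ Finset.range k, P.mesh j ^ 2 ≤ P.mesh k ^ 2 := by
    have e : ∀ j, P.mesh j ^ 2 = P.mesh 0 ^ 2 * ((P.L : ℝ) ^ 2) ^ j := by
      intro j; rw [mesh_eq_pow_mul P j]; ring
    rw [Finset.sum_congr rfl fun j _ => e j, ← Finset.mul_sum, e k]
    refine mul_le_mul_of_nonneg_left ?_ (sq_nonneg _)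
    have h4 : (2 : ℝ) ≤ (P.L : ℝ) ^ 2 := by nlinarith
    exact sum_pow_lt_le h4 k
  have hmesh1 : ∑ j ∈ Finset.range k, P.mesh j ≤ P.mesh k := by
    have e : ∀ j, P.mesh j = P.mesh 0 * (P.L : ℝ) ^ j := by
      intro j; rw [mesh_eq_pow_mul P j]; ring
    rw [Finset.sum_congr rfl fun j _ => e j, ← Finset.mul_sum, e k]
    exact mul_le_mul_of_nonneg_left (sum_pow_lt_le hL2 k) hεpos.le
  have hd1 : (1 : ℝ) ≤ d := by exact_mod_cast hd
  refine ⟨fun x hx => ⟨?_, ?_⟩, fun b hin => ?_⟩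
  · -- the value row of `G_k = Σ_j G^η_{(j)}`
    calc ∑ y ∈ Ω, ∑ i : Ix N, ‖propagatorK C Ω B msq a k (cb P N 0 (y, i)) x‖
        ≤ ∑ y ∈ Ω, ∑ i : Ix N, ∑ j ∈ Finset.range k, ‖pieceR C Ω B msq a k j (cb P N 0 (y, i)) x‖ := by
          refine Finset.sum_le_sum fun y _ => Finset.sum_le_sum fun i _ => ?_
          rw [← hsum, LinearMap.sum_apply, Finset.sum_apply]
          exact norm_sum_le _ _
      _ = ∑ y ∈ Ω, ∑ j ∈ Finset.range k, ∑ i : Ix N, ‖pieceR C Ω B msq a k j (cb P N 0 (y, i)) x‖ :=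
          Finset.sum_congr rfl fun y _ => Finset.sum_comm
      _ = ∑ j ∈ Finset.range k, ∑ y ∈ Ω, ∑ i : Ix N, ‖pieceR C Ω B msq a k j (cb P N 0 (y, i)) x‖ := Finset.sum_comm
      _ ≤ ∑ j ∈ Finset.range k, Cst * Kδ * P.mesh j ^ 2 := Finset.sum_le_sum fun j _ => hV x hx j
      _ = Cst * Kδ * ∑ j ∈ Finset.range k, P.mesh j ^ 2 := by rw [Finset.mul_sum]
      _ ≤ Cst * Kδ * P.mesh k ^ 2 := mul_le_mul_of_nonneg_left hmesh2 (by positivity)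
  · -- the derivative row
    calc ∑ b : HiggsLattice.PBond P 0, (if Inside Ω b then
            ∑ i : Ix N, ‖covDeriv C B (propagatorK C Ω B msq a k (cb P N 0 (x, i))) b‖ else 0)
        ≤ ∑ b : HiggsLattice.PBond P 0, ∑ j ∈ Finset.range k, (if Inside Ω b then
            ∑ i : Ix N, ‖covDeriv C B (pieceR C Ω B msq a k j (cb P N 0 (x, i))) b‖ else 0) := by
          refine Finset.sum_le_sum fun b _ => ?_
          split_ifs with hin
          · calc ∑ i : Ix N, ‖covDeriv C B (propagatorK C Ω B msq a k (cb P N 0 (x, i))) b‖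
                ≤ ∑ i : Ix N, ∑ j ∈ Finset.range k, ‖covDeriv C B (pieceR C Ω B msq a k j (cb P N 0 (x, i))) b‖ := by
                  refine Finset.sum_le_sum fun i _ => ?_
                  have e : covDeriv C B (propagatorK C Ω B msq a k (cb P N 0 (x, i))) b
                      = ∑ j ∈ Finset.range k, covDeriv C B (pieceR C Ω B msq a k j (cb P N 0 (x, i))) b := by
                    rw [← hsum, LinearMap.sum_apply]
                    have h := map_sum (B3Op116SourceForm.covDerivAt C B b)
                      (fun j => pieceR C Ω B msq a k j (cb P N 0 (x, i))) (Finset.range k)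
                    simpa only [B3Op116SourceForm.covDerivAt_apply] using h
                  rw [e]
                  exact norm_sum_le _ _
              _ = ∑ j ∈ Finset.range k, ∑ i : Ix N, ‖covDeriv C B (pieceR C Ω B msq a k j (cb P N 0 (x, i))) b‖ :=
                  Finset.sum_comm
          · simp
      _ = ∑ j ∈ Finset.range k, ∑ b : HiggsLattice.PBond P 0, (if Inside Ω b then
            ∑ i : Ix N, ‖covDeriv C B (pieceR C Ω B msq a k j (cb P N 0 (x, i))) b‖ else 0) := Finset.sum_comm
      _ ≤ ∑ j ∈ Finset.range k, Cst * Kδ * d * P.mesh j := Finset.sum_le_sum fun j _ => hD x hx j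
      _ = Cst * Kδ * d * ∑ j ∈ Finset.range k, P.mesh j := by rw [Finset.mul_sum]
      _ ≤ Cst * Kδ * d * P.mesh k := mul_le_mul_of_nonneg_left hmesh1 (by positivity)
  · -- the derivative column sum at the inside bond `b`
    calc ∑ y ∈ Ω, ∑ i : Ix N, ‖covDeriv C B (propagatorK C Ω B msq a k (cb P N 0 (y, i))) b‖
        ≤ ∑ y ∈ Ω, ∑ i : Ix N, ∑ j ∈ Finset.range k, ‖covDeriv C B (pieceR C Ω B msq a k j (cb P N 0 (y, i))) b‖ := by
          refine Finset.sum_le_sum fun y _ => Finset.sum_le_sum fun i _ => ?_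
          have e : covDeriv C B (propagatorK C Ω B msq a k (cb P N 0 (y, i))) b
              = ∑ j ∈ Finset.range k, covDeriv C B (pieceR C Ω B msq a k j (cb P N 0 (y, i))) b := by
            rw [← hsum, LinearMap.sum_apply]
            have h := map_sum (B3Op116SourceForm.covDerivAt C B b)
              (fun j => pieceR C Ω B msq a k j (cb P N 0 (y, i))) (Finset.range k)
            simpa only [B3Op116SourceForm.covDerivAt_apply] using h
          rw [e]
          exact norm_sum_le _ _
      _ = ∑ y ∈ Ω, ∑ j ∈ Finset.range k, ∑ i : Ix N, ‖covDeriv C B (pieceR C Ω B msq a k j (cb P N 0 (y, i))) b‖ :=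
          Finset.sum_congr rfl fun y _ => Finset.sum_comm
      _ = ∑ j ∈ Finset.range k, ∑ y ∈ Ω, ∑ i : Ix N, ‖covDeriv C B (pieceR C Ω B msq a k j (cb P N 0 (y, i))) b‖ :=
          Finset.sum_comm
      _ ≤ ∑ j ∈ Finset.range k, Cst * Kδ * P.mesh j := Finset.sum_le_sum fun j _ => hDT b hin j
      _ = Cst * Kδ * ∑ j ∈ Finset.range k, P.mesh j := by rw [Finset.mul_sum]
      _ ≤ Cst * Kδ * P.mesh k := mul_le_mul_of_nonneg_left hmesh1 (by positivity)
      _ ≤ Cst * Kδ * d * P.mesh k := by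
          have h0 : 0 ≤ Cst * Kδ * P.mesh k := by have := P.mesh_pos k; positivity
          nlinarith

end Rows

/-! ## §3 The two remainder terms of (2.68) through the rows of `G_k(□, B)` -/

section Remainders

variable (C : ChargeData N) {k : ℕ}

/-- a sum of block-supported weights against the columns: `Σ_y c·1_Ω(y)·κ(y) = c·Σ_{y∈Ω}κ(y)`. [folklore] -/
private theorem sum_ite_mul_eq (Ω : Finset (HiggsLattice.Site P 0)) (c : ℝ) (κ : HiggsLattice.Site P 0 → ℝ) :
    ∑ y : HiggsLattice.Site P 0, (if y ∈ Ω then c * κ y else 0) = c * ∑ y ∈ Ω, κ y := by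
  rw [Finset.sum_ite_mem, Finset.univ_inter, Finset.mul_sum]

/-- **THE `F₂` TERM OF (2.68)**: `‖a_kℓ⁻²(G_k(□, B)F_{2,k}(A′, B)^*□₁φ)(x)‖ ≤ a_kℓ⁻²·|e|sεd(Lᵏ−1)·t·Σ_{y∈□}Σ_i‖(G_k(□,B)e_{(y,i)})(x)‖`
for `sup_b|A′_b| ≤ s`, `|φ| ≤ t` on `□₁ ⊆ □₂`, `k ≤ K` (`‖(F₂^*ψ)(y)‖ ≤ |e|sεd(Lᵏ−1)‖ψ(y_k)‖`, p40; the source vanishes off `Bᵏ(□₁)`).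
[cite: Balaban1982Higgs2, Lemma 2.4 proof (2.68) p.572] [cite: Balaban1982Higgs1, (3.15)–(3.16) pp.614–615] -/
theorem norm_T1_le (hk : k ≤ P.K) {sq₂ sq₁ : Finset (HiggsLattice.Site P k)} (h12 : sq₁ ⊆ sq₂)
    (A' B : HiggsLattice.VecField P 0) {s : ℝ} (hs : 0 ≤ s) (hA : ∀ b : HiggsLattice.PBond P 0, |A' b| ≤ s) (msq a : ℝ)
    (φ : HiggsLattice.ScalarField P k N) {t : ℝ} (ht : 0 ≤ t) (hφ : ∀ y ∈ sq₁, ‖φ y‖ ≤ t) (x : HiggsLattice.Site P 0) :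
    ‖propagatorK C (underRegion k sq₂) B msq a k (fTwoAdj C A' B k (cutTo sq₁ φ)) x‖
      ≤ |C.e| * s * P.mesh 0 * (P.d * ((P.L : ℝ) ^ k - 1)) * t *
          ∑ y ∈ underRegion k sq₂, ∑ i : Ix N, ‖propagatorK C (underRegion k sq₂) B msq a k (cb P N 0 (y, i)) x‖ := by
  set Ω := underRegion k sq₂ with hΩdef
  set m : ℝ := |C.e| * s * P.mesh 0 * (P.d * ((P.L : ℝ) ^ k - 1)) with hm
  set T : HiggsLattice.ScalarField P 0 N →ₗ[ℝ] E N :=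
    (LinearMap.proj x : HiggsLattice.ScalarField P 0 N →ₗ[ℝ] E N) ∘ₗ propagatorK C Ω B msq a k with hT
  have hTapp : ∀ f, T f = propagatorK C Ω B msq a k f x := fun f => rfl
  have hm0 : 0 ≤ m := by
    have hL1 : (1 : ℝ) ≤ (P.L : ℝ) ^ k := one_le_pow₀ (by exact_mod_cast (P.hL : 1 ≤ P.L))
    have := P.mesh_pos 0
    rw [hm]
    exact mul_nonneg (by positivity) (mul_nonneg (Nat.cast_nonneg _) (by linarith))
  have h := norm_mapE_le_sum_norm_mul_col T (fTwoAdj C A' B k (cutTo sq₁ φ))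
  rw [hTapp] at h
  simp only [hTapp] at h
  refine h.trans ?_
  have hy : ∀ y : HiggsLattice.Site P 0,
      ‖fTwoAdj C A' B k (cutTo sq₁ φ) y‖ * ∑ i : Ix N, ‖propagatorK C Ω B msq a k (cb P N 0 (y, i)) x‖
        ≤ if y ∈ Ω then m * t * ∑ i : Ix N, ‖propagatorK C Ω B msq a k (cb P N 0 (y, i)) x‖ else 0 := by
    intro y
    have hcol : 0 ≤ ∑ i : Ix N, ‖propagatorK C Ω B msq a k (cb P N 0 (y, i)) x‖ :=
      Finset.sum_nonneg fun _ _ => norm_nonneg _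
    have hf := norm_fTwoAdj_apply_le C A' B k hk hs hA (cutTo sq₁ φ) y
    split_ifs with hyΩ
    · refine mul_le_mul_of_nonneg_right (hf.trans (mul_le_mul_of_nonneg_left ?_ hm0)) hcol
      by_cases h1 : blockIter k y ∈ sq₁
      · rw [cutTo_of_mem sq₁ φ h1]; exact hφ _ h1
      · rw [cutTo_of_not_mem sq₁ φ h1, norm_zero]; exact ht
    · have h1 : blockIter k y ∉ sq₁ := fun h' => hyΩ ((mem_underRegion k sq₂ y).2 (h12 h'))
      rw [cutTo_of_not_mem sq₁ φ h1, norm_zero, mul_zero] at hf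
      have h0 : ‖fTwoAdj C A' B k (cutTo sq₁ φ) y‖ = 0 := le_antisymm hf (norm_nonneg _)
      rw [h0, zero_mul]
  refine (Finset.sum_le_sum fun y _ => hy y).trans ?_
  rw [sum_ite_mul_eq]

/-- the inside-bond sum of a column functional read at the bond targets is at most `d` times the site sum over `Ω`. [folklore] -/
private theorem sum_inside_tgt_le (Ω : Finset (HiggsLattice.Site P 0)) (κ : HiggsLattice.Site P 0 → ℝ) (hκ : ∀ y, 0 ≤ κ y) :
    ∑ b : HiggsLattice.PBond P 0, (if Inside Ω b then κ b.tgt else 0) ≤ P.d * ∑ y ∈ Ω, κ y := by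
  calc ∑ b : HiggsLattice.PBond P 0, (if Inside Ω b then κ b.tgt else 0)
      ≤ ∑ b : HiggsLattice.PBond P 0, (if b.tgt ∈ Ω then κ b.tgt else 0) := by
        refine Finset.sum_le_sum fun b _ => ?_
        by_cases h : Inside Ω b
        · rw [if_pos h, if_pos h.2]
        · rw [if_neg h]; split_ifs <;> simp [hκ]
    _ = ∑ z : HiggsLattice.Site P 0, ∑ μ : Fin P.d, (if z.shift μ ∈ Ω then κ (z.shift μ) else 0) := by
        rw [sum_site_dir]; rfl
    _ = ∑ μ : Fin P.d, ∑ z : HiggsLattice.Site P 0, (if z.shift μ ∈ Ω then κ (z.shift μ) else 0) := Finset.sum_comm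
    _ = ∑ _μ : Fin P.d, ∑ y ∈ Ω, κ y := by
        refine Finset.sum_congr rfl fun μ _ => ?_
        rw [Fintype.sum_equiv (shiftEquiv P 0 μ) (fun z => if z.shift μ ∈ Ω then κ (z.shift μ) else 0)
          (fun y => if y ∈ Ω then κ y else 0) (fun z => rfl), Finset.sum_ite_mem, Finset.univ_inter]
    _ = P.d * ∑ y ∈ Ω, κ y := by rw [Finset.sum_const, Finset.card_univ, Fintype.card_fin, nsmul_eq_mul]

/-- **THE `V_k` TERM OF (2.68)**: for `Ω` a union of `k`-blocks, `w` supported in `Ω` with `|w| ≤ W₀`, `|(D_Bw)(b)| ≤ W₁` on the bonds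
inside `Ω`, `sup_b|A′_b| ≤ s`, `k ≤ K`:
`‖(G_k(Ω,B)V_k(A′,B)w)(x)‖ ≤ [|e|s·d·(W₁ + |e|sW₀) + |a_k|ℓ⁻²(2m + m²)W₀]·Σ_{y∈Ω}Σ_i‖(G_k(Ω,B)e_{(y,i)})(x)‖ + |e|sW₀·Σ_{b⊂Ω}Σ_i‖(D_BG_k(Ω,B)e_{(x,i)})(b)‖`,
`m = |e|sεd(Lᵏ−1)` (r14's source form of `V_k` and row toolkit; the averaging sources vanish off `Ω`).
[cite: Balaban1982Higgs2, Lemma 2.4 proof (2.68) p.572] [cite: Balaban1982Higgs1, (3.16) p.615, (3.44) p.619] -/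
theorem norm_T2_le (hk : k ≤ P.K) {Ω : Finset (HiggsLattice.Site P 0)}
    (hΩ : ∀ x x' : HiggsLattice.Site P 0, blockIter k x = blockIter k x' → (x ∈ Ω ↔ x' ∈ Ω))
    (A' B : HiggsLattice.VecField P 0) {s : ℝ} (hs : 0 ≤ s) (hA : ∀ b : HiggsLattice.PBond P 0, |A' b| ≤ s) (msq a : ℝ)
    (w : HiggsLattice.ScalarField P 0 N) (hw0 : ∀ y, y ∉ Ω → w y = 0) {W₀ W₁ : ℝ} (hW₀ : ∀ y, ‖w y‖ ≤ W₀)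
    (hW₁nn : 0 ≤ W₁) (hW₁ : ∀ b : HiggsLattice.PBond P 0, Inside Ω b → ‖covDeriv C B w b‖ ≤ W₁)
    (x : HiggsLattice.Site P 0) :
    ‖propagatorK C Ω B msq a k (opV C Ω A' B msq a k w) x‖
      ≤ (|C.e| * s * (P.d * (W₁ + |C.e| * s * W₀))
          + |B1.aSeq a P.L k| * (P.mesh k)⁻¹ ^ 2 *
              ((2 * (|C.e| * s * P.mesh 0 * (P.d * ((P.L : ℝ) ^ k - 1)))
                + (|C.e| * s * P.mesh 0 * (P.d * ((P.L : ℝ) ^ k - 1))) ^ 2) * W₀)) *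
            ∑ y ∈ Ω, ∑ i : Ix N, ‖propagatorK C Ω B msq a k (cb P N 0 (y, i)) x‖
        + |C.e| * s * W₀ *
            ∑ b : HiggsLattice.PBond P 0, (if Inside Ω b then
              ∑ i : Ix N, ‖covDeriv C B (propagatorK C Ω B msq a k (cb P N 0 (x, i))) b‖ else 0) := by
  set m : ℝ := |C.e| * s * P.mesh 0 * (P.d * ((P.L : ℝ) ^ k - 1)) with hm
  set col : HiggsLattice.Site P 0 → ℝ := fun y => ∑ i : Ix N, ‖propagatorK C Ω B msq a k (cb P N 0 (y, i)) x‖ with hcol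
  set dcol : HiggsLattice.PBond P 0 → ℝ := fun b =>
    ∑ i : Ix N, ‖covDeriv C B (propagatorK C Ω B msq a k (cb P N 0 (x, i))) b‖ with hdcol
  have hcol0 : ∀ y, 0 ≤ col y := fun y => Finset.sum_nonneg fun _ _ => norm_nonneg _
  have hdcol0 : ∀ b, 0 ≤ dcol b := fun b => Finset.sum_nonneg fun _ _ => norm_nonneg _
  have hW₀0 : 0 ≤ W₀ := (norm_nonneg _).trans (hW₀ x)
  have hes : 0 ≤ |C.e| * s := mul_nonneg (abs_nonneg _) hs
  have hm0 : 0 ≤ m := by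
    have hL1 : (1 : ℝ) ≤ (P.L : ℝ) ^ k := one_le_pow₀ (by exact_mod_cast (P.hL : 1 ≤ P.L))
    have := P.mesh_pos 0
    rw [hm]
    exact mul_nonneg (by positivity) (mul_nonneg (Nat.cast_nonneg _) (by linarith))
  rw [opV_apply_eq_srcV C A' B msq w]
  have hrow := norm_propagatorK_srcV_apply_le C Ω A' B a k B msq hA w x
  refine hrow.trans ?_
  -- (i) the bond sources
  have hbond : ∀ b : HiggsLattice.PBond P 0, (if Inside Ω b then
      |C.e| * s * ‖covDeriv C B w b‖ * col b.tgt + |C.e| * s * ‖w b.tgt‖ * dcol b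
        + (|C.e| * s) ^ 2 * ‖w b.tgt‖ * col b.tgt else 0)
      ≤ (if Inside Ω b then (|C.e| * s * W₁ + (|C.e| * s) ^ 2 * W₀) * col b.tgt else 0)
        + |C.e| * s * W₀ * (if Inside Ω b then dcol b else 0) := by
    intro b
    split_ifs with hin
    · have h1 : |C.e| * s * ‖covDeriv C B w b‖ * col b.tgt ≤ |C.e| * s * W₁ * col b.tgt :=
        mul_le_mul_of_nonneg_right (mul_le_mul_of_nonneg_left (hW₁ b hin) hes) (hcol0 _)
      have h2 : |C.e| * s * ‖w b.tgt‖ * dcol b ≤ |C.e| * s * W₀ * dcol b :=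
        mul_le_mul_of_nonneg_right (mul_le_mul_of_nonneg_left (hW₀ _) hes) (hdcol0 _)
      have h3 : (|C.e| * s) ^ 2 * ‖w b.tgt‖ * col b.tgt ≤ (|C.e| * s) ^ 2 * W₀ * col b.tgt :=
        mul_le_mul_of_nonneg_right (mul_le_mul_of_nonneg_left (hW₀ _) (sq_nonneg _)) (hcol0 _)
      nlinarith
    · simp
  have hsum1 : ∑ b : HiggsLattice.PBond P 0, (if Inside Ω b then
      |C.e| * s * ‖covDeriv C B w b‖ * col b.tgt + |C.e| * s * ‖w b.tgt‖ * dcol b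
        + (|C.e| * s) ^ 2 * ‖w b.tgt‖ * col b.tgt else 0)
      ≤ (|C.e| * s * W₁ + (|C.e| * s) ^ 2 * W₀) * (P.d * ∑ y ∈ Ω, col y)
        + |C.e| * s * W₀ * ∑ b : HiggsLattice.PBond P 0, (if Inside Ω b then dcol b else 0) := by
    refine (Finset.sum_le_sum fun b _ => hbond b).trans ?_
    rw [Finset.sum_add_distrib, ← Finset.mul_sum]
    refine add_le_add ?_ le_rfl
    have hc0 : 0 ≤ |C.e| * s * W₁ + (|C.e| * s) ^ 2 * W₀ := add_nonneg (mul_nonneg hes hW₁nn) (by positivity)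
    have h := sum_inside_tgt_le Ω (fun y => (|C.e| * s * W₁ + (|C.e| * s) ^ 2 * W₀) * col y)
      (fun y => mul_nonneg hc0 (hcol0 y))
    refine h.trans (le_of_eq ?_)
    rw [Finset.mul_sum, Finset.mul_sum, Finset.mul_sum]
    refine Finset.sum_congr rfl fun y _ => ?_
    ring
  -- (ii) the averaging sources
  set T : HiggsLattice.ScalarField P 0 N →ₗ[ℝ] E N :=
    (LinearMap.proj x : HiggsLattice.ScalarField P 0 N →ₗ[ℝ] E N) ∘ₗ propagatorK C Ω B msq a k with hT
  have hTapp : ∀ f, T f = propagatorK C Ω B msq a k f x := fun f => rfl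
  have havg := norm_mapE_avgSrc_le (C := C) (A := A') (B := B) (k := k) T hk hs hA w
  simp only [hTapp] at havg
  have hQ0 : ∀ y : HiggsLattice.Site P 0, y ∉ Ω → ∀ X : HiggsLattice.VecField P 0, avgQkLin C X k w (blockIter k y) = 0 := by
    intro y hy X
    rw [HiggsCovariance.avgQkLin_apply]
    exact avgQk_blockIter_eq_zero C hΩ X w hw0 hy
  have hF0 : ∀ y : HiggsLattice.Site P 0, y ∉ Ω → fTwo C A' B k w (blockIter k y) = 0 := by
    intro y hy
    rw [fTwo, LinearMap.sub_apply, Pi.sub_apply, hQ0 y hy, hQ0 y hy, sub_zero]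
  have hmean : ∀ y' : HiggsLattice.Site P k, ‖fTwo C A' B k w y'‖ ≤ m * W₀ := by
    intro y'
    refine (norm_fTwo_apply_le C A' B k hk hs hA w y').trans (mul_le_mul_of_nonneg_left ?_ hm0)
    have hL : (0 : ℝ) < (P.L : ℝ) ^ (k * P.d) := pow_pos (by exact_mod_cast P.hL) _
    rw [inv_mul_le_iff₀ hL]
    calc ∑ x ∈ blockK k y', ‖w x‖ ≤ ∑ _x ∈ blockK k y', W₀ := Finset.sum_le_sum fun z _ => hW₀ z
      _ = (P.L : ℝ) ^ (k * P.d) * W₀ := by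
          rw [Finset.sum_const, card_blockK hk, nsmul_eq_mul]; push_cast; ring
  have hyavg : ∀ y : HiggsLattice.Site P 0,
      (m * ‖avgQkLin C B k w (blockIter k y)‖ + ‖fTwo C A' B k w (blockIter k y)‖
          + m * ‖fTwo C A' B k w (blockIter k y)‖) * col y
        ≤ if y ∈ Ω then (2 * m + m ^ 2) * W₀ * col y else 0 := by
    intro y
    split_ifs with hy
    · refine mul_le_mul_of_nonneg_right ?_ (hcol0 y)
      have h1 : ‖avgQkLin C B k w (blockIter k y)‖ ≤ W₀ := norm_avgQkLin_apply_le C B hk w hW₀ _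
      have h2 := hmean (blockIter k y)
      nlinarith [mul_le_mul_of_nonneg_left h1 hm0, mul_le_mul_of_nonneg_left h2 hm0, norm_nonneg (fTwo C A' B k w (blockIter k y))]
    · rw [hQ0 y hy B, hF0 y hy, norm_zero, mul_zero, add_zero, add_zero, zero_mul]
  have hsum2 : ‖propagatorK C Ω B msq a k (avgSrc C A' B k w) x‖ ≤ (2 * m + m ^ 2) * W₀ * ∑ y ∈ Ω, col y := by
    refine havg.trans ((Finset.sum_le_sum fun y _ => hyavg y).trans (le_of_eq ?_))
    rw [sum_ite_mul_eq]
  -- assemble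
  have hak : 0 ≤ |B1.aSeq a P.L k| * (P.mesh k)⁻¹ ^ 2 := by positivity
  calc (∑ b : HiggsLattice.PBond P 0, (if Inside Ω b then
          |C.e| * s * ‖covDeriv C B w b‖ * col b.tgt + |C.e| * s * ‖w b.tgt‖ * dcol b
            + (|C.e| * s) ^ 2 * ‖w b.tgt‖ * col b.tgt else 0))
        + |B1.aSeq a P.L k| * (P.mesh k)⁻¹ ^ 2 * ‖propagatorK C Ω B msq a k (avgSrc C A' B k w) x‖
      ≤ ((|C.e| * s * W₁ + (|C.e| * s) ^ 2 * W₀) * (P.d * ∑ y ∈ Ω, col y)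
          + |C.e| * s * W₀ * ∑ b : HiggsLattice.PBond P 0, (if Inside Ω b then dcol b else 0))
        + |B1.aSeq a P.L k| * (P.mesh k)⁻¹ ^ 2 * ((2 * m + m ^ 2) * W₀ * ∑ y ∈ Ω, col y) :=
        add_le_add hsum1 (mul_le_mul_of_nonneg_left hsum2 hak)
    _ = (|C.e| * s * (P.d * (W₁ + |C.e| * s * W₀))
          + |B1.aSeq a P.L k| * (P.mesh k)⁻¹ ^ 2 * ((2 * m + m ^ 2) * W₀)) * ∑ y ∈ Ω, col y
        + |C.e| * s * W₀ * ∑ b : HiggsLattice.PBond P 0, (if Inside Ω b then dcol b else 0) := by ring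

end Remainders

/-! ## §4 (2.68) with explicit remainder on a cell-product box -/

section Eq268

/-- **(2.68) ON THE (Higgs)₂,₃ CARRIER — THE REMAINDER BOUNDED** (ε-lattice currency, `ℓ = Lᵏε`, `κ = a_kℓ⁻²`, `m = |e|sεd(Lᵏ−1)`).
For `d ≥ 1`, `L ≥ 2`, `a, m² > 0`, `N`, charge data: there are `K₀min` and, per `K₀ ≥ K₀min`, a threshold `t > 0` and constants
`C₁, C₂ ≥ 0` such that on every torus of the carrier with `K₀ ∣ M`, at every level `1 ≤ k ≤ K_P` with `3LᵏK₀ ≤ |T_ε|_μ`, `Lᵏε ≤ 1`, for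
every pair `□₁ ⊆ □₂ ⊂ T^{(k)}` with `□ = Bᵏ(□₂)` a cell-product box of big blocks, every background `B` with `|B(z+e_ν,μ) − B(z,μ)| ≤ δ_B` on
`□` and `Lᵏδ_B|e| ≤ t` (print: the constant field `A₀`, `δ_B = 0`), every `A′` with `|A′_b| ≤ s`, every `φ` with `|φ| ≤ t′` on `□₁`, all
bounds `|w| ≤ W₀`, `|(D_Bw)(b)| ≤ W₁` (`b ⊂ □`, `W₁ ≥ 0`) for the small-field background `w = φ^{(k)}_□ = a_kG_k(□, A′+B)Q_k^*(A′+B)□₁φ` itself, and every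
`x ∈ □`:
`‖(a_kG_k(□,A′+B)Q_k^*(A′+B)□₁φ)(x) − (a_kG_k(□,B)Q_k^*(B)□₁φ)(x)‖ ≤ C₁ℓ²·[κmt′ + |e|sd(W₁ + |e|sW₀) + κ(2m + m²)W₀] + C₂ℓ·|e|sW₀` —
print's «= (a_kG_k(□, A₀)Q_k^*(A₀)□₁φ)(x) + O((Lᵏε)^{κ₀})» with the remainder explicit.
[cite: Balaban1982Higgs2, Lemma 2.4 proof (2.68) p.572] [cite: Balaban1982Higgs1, (3.44) p.619] [cite: Balaban1983Higgs3, (2.10) p.426] -/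
theorem eq268_box (d L : ℕ) (hd : 1 ≤ d) (hL : 2 ≤ L) {a : ℝ} (ha : 0 < a) {msq : ℝ} (hmsq : 0 < msq)
    (N : ℕ) (C : ChargeData N) :
    ∃ K₀min : ℕ, ∀ K₀ : ℕ, K₀min ≤ K₀ → ∃ t C₁ C₂ : ℝ, 0 < t ∧ 0 ≤ C₁ ∧ 0 ≤ C₂ ∧
      ∀ (P : HiggsLattice.Params), P.d = d → P.L = L → K₀ ∣ P.M →
      ∀ {k : ℕ}, 1 ≤ k → k ≤ P.K → (∀ μ, 3 * half P k K₀ ≤ P.sitesPerDir 0 μ) → P.mesh k ≤ 1 →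
      ∀ (S : Fin P.d → Finset ℕ) (sq₂ sq₁ : Finset (HiggsLattice.Site P k)),
        underRegion k sq₂ = cellBox k K₀ S → sq₁ ⊆ sq₂ →
      ∀ (B : HiggsLattice.VecField P 0) {δB : ℝ}, 0 ≤ δB →
        (∀ z ∈ underRegion k sq₂, ∀ μ ν : Fin P.d, |B ⟨z.shift ν, μ⟩ - B ⟨z, μ⟩| ≤ δB) →
        (P.L : ℝ) ^ k * δB * |C.e| ≤ t →
      ∀ (A' : HiggsLattice.VecField P 0) {s : ℝ}, 0 ≤ s → (∀ b : HiggsLattice.PBond P 0, |A' b| ≤ s) →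
      ∀ (φ : HiggsLattice.ScalarField P k N) {t' : ℝ}, 0 ≤ t' → (∀ y ∈ sq₁, ‖φ y‖ ≤ t') →
      ∀ {W₀ W₁ : ℝ}, (∀ y, ‖bgScalar256 C msq a k sq₂ sq₁ (A' + B) φ y‖ ≤ W₀) → 0 ≤ W₁ →
        (∀ b : HiggsLattice.PBond P 0, Inside (underRegion k sq₂) b →
            ‖covDeriv C B (bgScalar256 C msq a k sq₂ sq₁ (A' + B) φ) b‖ ≤ W₁) →
      ∀ x ∈ underRegion k sq₂,
        ‖bgScalar256 C msq a k sq₂ sq₁ (A' + B) φ x - bgScalar256 C msq a k sq₂ sq₁ B φ x‖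
          ≤ C₁ * P.mesh k ^ 2 *
              (B1.aSeq a P.L k * (P.mesh k)⁻¹ ^ 2 * (|C.e| * s * P.mesh 0 * (P.d * ((P.L : ℝ) ^ k - 1))) * t'
                + |C.e| * s * (P.d * (W₁ + |C.e| * s * W₀))
                + B1.aSeq a P.L k * (P.mesh k)⁻¹ ^ 2 *
                    ((2 * (|C.e| * s * P.mesh 0 * (P.d * ((P.L : ℝ) ^ k - 1)))
                      + (|C.e| * s * P.mesh 0 * (P.d * ((P.L : ℝ) ^ k - 1))) ^ 2) * W₀))
            + C₂ * P.mesh k * (|C.e| * s * W₀) := by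
  obtain ⟨K₀min, hR⟩ := row_sums_box d L hd hL ha hmsq N C
  refine ⟨K₀min, fun K₀ hK₀ => ?_⟩
  obtain ⟨t, C₁, C₂, ht, hC₁, hC₂, hR⟩ := hR K₀ hK₀
  refine ⟨t, C₁, C₂, ht, hC₁, hC₂, ?_⟩
  intro P hPd hPL hK₀M k hk1 hkK h3 hmesh S sq₂ sq₁ hbox h12 B δB hδB hreg ht' A' s hs hA φ t' ht0 hφ W₀ W₁ hW₀ hW₁nn hW₁ x hx
  have hLr : (1 : ℝ) < P.L := by rw [hPL]; exact_mod_cast (by omega : 1 < L)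
  have hak : 0 ≤ B1.aSeq a P.L k := (B1.aSeq_pos ha hLr hk1).le
  set Ω := underRegion k sq₂ with hΩdef
  have hΩ : ∀ x x' : HiggsLattice.Site P 0, blockIter k x = blockIter k x' → (x ∈ Ω ↔ x' ∈ Ω) := by
    intro y y' h
    rw [hΩdef, mem_underRegion, mem_underRegion, h]
  -- the rows of `G_k(□, B)` on the box
  have hreg' : ∀ z ∈ cellBox k K₀ S, ∀ μ ν : Fin P.d, |B ⟨z.shift ν, μ⟩ - B ⟨z, μ⟩| ≤ δB := by
    rw [← hbox]; exact hreg
  have hx' : x ∈ cellBox k K₀ S := by rw [← hbox]; exact hx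
  obtain ⟨hR₀, hR₁⟩ := (hR P hPd hPL hK₀M hk1 hkK h3 hmesh S B hδB hreg' ht').1 x hx'
  rw [← hbox] at hR₀ hR₁
  -- the identity and the two remainder terms
  set w := bgScalar256 C msq a k sq₂ sq₁ (A' + B) φ with hw
  have hw0 : ∀ y, y ∉ Ω → w y = 0 := fun y hy => bgScalar256_eq_zero_of_not_mem hmsq hak h12 (A' + B) φ hy
  have hid := eq268_identity C sq₂ sq₁ A' B hmsq a hak φ
  have hT1 := norm_T1_le C hkK h12 A' B hs hA msq a φ ht0 hφ x
  have hT2 := norm_T2_le C hkK hΩ A' B hs hA msq a w hw0 hW₀ hW₁nn hW₁ x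
  have hκ : 0 ≤ B1.aSeq a P.L k * (P.mesh k ^ 2)⁻¹ := mul_nonneg hak (inv_nonneg.2 (sq_nonneg _))
  have hdiff : bgScalar256 C msq a k sq₂ sq₁ (A' + B) φ x - bgScalar256 C msq a k sq₂ sq₁ B φ x
      = (B1.aSeq a P.L k * (P.mesh k ^ 2)⁻¹) •
          propagatorK C Ω B msq a k (fTwoAdj C A' B k (cutTo sq₁ φ)) x
        + propagatorK C Ω B msq a k (opV C Ω A' B msq a k w) x := by
    rw [hid, hw]
    simp only [Pi.add_apply, Pi.smul_apply]
    abel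
  rw [hdiff]
  have hes : 0 ≤ |C.e| * s := mul_nonneg (abs_nonneg _) hs
  have hW₀0 : 0 ≤ W₀ := (norm_nonneg _).trans (hW₀ x)
  have hm0 : 0 ≤ |C.e| * s * P.mesh 0 * (P.d * ((P.L : ℝ) ^ k - 1)) := by
    have hL1 : (1 : ℝ) ≤ (P.L : ℝ) ^ k := one_le_pow₀ hLr.le
    have := P.mesh_pos 0
    exact mul_nonneg (by positivity) (mul_nonneg (Nat.cast_nonneg _) (by linarith))
  have hW₁0 : 0 ≤ W₁ + |C.e| * s * W₀ := add_nonneg hW₁nn (mul_nonneg hes hW₀0)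
  calc ‖(B1.aSeq a P.L k * (P.mesh k ^ 2)⁻¹) • propagatorK C Ω B msq a k (fTwoAdj C A' B k (cutTo sq₁ φ)) x
          + propagatorK C Ω B msq a k (opV C Ω A' B msq a k w) x‖
      ≤ (B1.aSeq a P.L k * (P.mesh k ^ 2)⁻¹) * ‖propagatorK C Ω B msq a k (fTwoAdj C A' B k (cutTo sq₁ φ)) x‖
          + ‖propagatorK C Ω B msq a k (opV C Ω A' B msq a k w) x‖ := by
        refine (norm_add_le _ _).trans (add_le_add (le_of_eq ?_) le_rfl)
        rw [norm_smul, Real.norm_eq_abs, abs_of_nonneg hκ]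
    _ ≤ (B1.aSeq a P.L k * (P.mesh k ^ 2)⁻¹) *
          (|C.e| * s * P.mesh 0 * (P.d * ((P.L : ℝ) ^ k - 1)) * t' *
            ∑ y ∈ Ω, ∑ i : Ix N, ‖propagatorK C Ω B msq a k (cb P N 0 (y, i)) x‖)
          + ((|C.e| * s * (P.d * (W₁ + |C.e| * s * W₀))
              + |B1.aSeq a P.L k| * (P.mesh k)⁻¹ ^ 2 *
                ((2 * (|C.e| * s * P.mesh 0 * (P.d * ((P.L : ℝ) ^ k - 1)))
                  + (|C.e| * s * P.mesh 0 * (P.d * ((P.L : ℝ) ^ k - 1))) ^ 2) * W₀)) *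
              ∑ y ∈ Ω, ∑ i : Ix N, ‖propagatorK C Ω B msq a k (cb P N 0 (y, i)) x‖
            + |C.e| * s * W₀ *
              ∑ b : HiggsLattice.PBond P 0, (if Inside Ω b then
                ∑ i : Ix N, ‖covDeriv C B (propagatorK C Ω B msq a k (cb P N 0 (x, i))) b‖ else 0)) :=
        add_le_add (mul_le_mul_of_nonneg_left hT1 hκ) hT2
    _ ≤ (B1.aSeq a P.L k * (P.mesh k ^ 2)⁻¹) *
          (|C.e| * s * P.mesh 0 * (P.d * ((P.L : ℝ) ^ k - 1)) * t' * (C₁ * P.mesh k ^ 2))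
          + ((|C.e| * s * (P.d * (W₁ + |C.e| * s * W₀))
              + |B1.aSeq a P.L k| * (P.mesh k)⁻¹ ^ 2 *
                ((2 * (|C.e| * s * P.mesh 0 * (P.d * ((P.L : ℝ) ^ k - 1)))
                  + (|C.e| * s * P.mesh 0 * (P.d * ((P.L : ℝ) ^ k - 1))) ^ 2) * W₀)) * (C₁ * P.mesh k ^ 2)
            + |C.e| * s * W₀ * (C₂ * P.mesh k)) := by
        refine add_le_add (mul_le_mul_of_nonneg_left (mul_le_mul_of_nonneg_left hR₀ (mul_nonneg hm0 ht0)) hκ)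
          (add_le_add (mul_le_mul_of_nonneg_left hR₀ ?_) (mul_le_mul_of_nonneg_left hR₁ (mul_nonneg hes hW₀0)))
        exact add_nonneg (mul_nonneg hes (mul_nonneg (Nat.cast_nonneg _) hW₁0)) (by positivity)
    _ = C₁ * P.mesh k ^ 2 *
            (B1.aSeq a P.L k * (P.mesh k)⁻¹ ^ 2 * (|C.e| * s * P.mesh 0 * (P.d * ((P.L : ℝ) ^ k - 1))) * t'
              + |C.e| * s * (P.d * (W₁ + |C.e| * s * W₀))
              + B1.aSeq a P.L k * (P.mesh k)⁻¹ ^ 2 *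
                  ((2 * (|C.e| * s * P.mesh 0 * (P.d * ((P.L : ℝ) ^ k - 1)))
                    + (|C.e| * s * P.mesh 0 * (P.d * ((P.L : ℝ) ^ k - 1))) ^ 2) * W₀))
          + C₂ * P.mesh k * (|C.e| * s * W₀) := by
        rw [abs_of_nonneg hak, inv_pow]
        ring

end Eq268

end Literature.MathematicalPhysics.QuantumFieldTheory.Balaban1983to89.B2Eq268HiggsRegion

end
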